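import Mathlib
import HarnessLib
import Summits.ValiantsHypothesis.ValiantsHypothesis.Theorems.MonotoneRestorationOrbitCompressionQPOrbitToNarrowOfDescent
import Summits.ValiantsHypothesis.ValiantsHypothesis.Theorems.MonotoneRestorationOrbitRestorationQPHomSpan
import Literature.Computability.AlgebraicComplexity.QPBoundedClosure

/-!
# Route MonotoneRestoration — aside `OrbitCompressionQP` (stmt-ValiantsHypothesis-18332), line
# `expression_compression`: THE LEVEL FLOOR — at level `n` every matrix-symmetric polynomial is bipartitely narrow
# of width `2n - 1`, in every degree

Part 1/2 of "the repaired first stub ⟺ qp-descent" (`…OrbitCompressionQPStubOneIffDescent.lean`).  The diagonal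
argument there needs to know that a FAILURE of width-`(log₂ n + c')^{c'}` descent (a matrix-symmetric polynomial at
level `n` outside the bipartite narrow span of that width) can only occur at a level `n ≥ 2` with `c' < 2n`.  This is
the LEVEL FLOOR:

  ★ `mem_narrowSpan_level_of_matrixSymmetric` : every matrix-symmetric `p` on the `n × n` matrix lies in
    `span_ℂ {hom_{F,n} : F a bipartite pattern of treewidth ≤ 2n - 1}` — the treewidth filtration of the
    matrix-symmetric polynomials at level `n` is EXHAUSTED at width `2n - 1`, in EVERY degree.

Proof: the Reynolds / orbit-sum induction of `HomSpan.orbitSum_mem_span_homPoly` (Dwivedi–Pago–Seppelt 2026 §8,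
spanning half), re-run with the LEVEL instead of the degree as the bound on the number of row and column vertices of
the spanning patterns (a monomial on the `n × n` matrix uses at most `n` rows and `n` columns; non-injective
placements use fewer), then `treewidth ≤ #vertices − 1`.

* `homPoly_mem_levelSet`, `orbitSum_mem_span_homPoly_level`, `mem_span_homPoly_level_of_matrixSymmetric`,
  ★ `mem_narrowSpan_level_of_matrixSymmetric`;
* `two_le_of_not_mem`, `lt_level_of_not_mem` — a width-`(log₂ n + c')^{c'}` failure has `2 ≤ n` and `c' < 2n`.

Def-free helper (`--supports stmt-ValiantsHypothesis-18332`); nothing here is a named fact.  Honest label: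
bookkeeping (VH-free); the stubs, the aside and VP ≠ VNP are NOT moved.

References: Dwivedi–Pago–Seppelt 2026 (arXiv:2601.09343) §8 (Lemma 8.18); Dawar–Pago–Seppelt 2025 (arXiv:2502.06740) §7.
-/

noncomputable section

open scoped Classical

-- `Summit.ValiantsHypothesis.ValiantsHypothesis.…` is the tree's single-conjunct layout (Sub = Summit).
set_option linter.dupNamespace false

namespace Summit.ValiantsHypothesis.ValiantsHypothesis.Theorems

namespace LevelFloor

open Literature.Computability.AlgebraicComplexity MvPolynomial
open Literature.Combinatorics.SimpleGraph (treewidth)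

/-! ### The level floor: matrix-symmetric polynomials at level `n` are bipartitely narrow of width `2n - 1` -/

/-- Transport of a pattern on finite vertex types with `≤ n` rows and `≤ n` columns to `Fin a × Fin b`,
`a, b ≤ n`. [folklore] -/
theorem homPoly_mem_levelSet {A B : Type} [Fintype A] [DecidableEq A] [Fintype B] [DecidableEq B]
    (E : Multiset (A × B)) (n : ℕ) (hA : Fintype.card A ≤ n) (hB : Fintype.card B ≤ n) :
    homPoly E n ℂ ∈ {q : MvPolynomial (Fin n × Fin n) ℂ | ∃ (a b : ℕ) (E' : Multiset (Fin a × Fin b)),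
      a ≤ n ∧ b ≤ n ∧ q = homPoly E' n ℂ} := by
  refine ⟨Fintype.card A, Fintype.card B,
    E.map fun e => (Fintype.equivFin A e.1, Fintype.equivFin B e.2), hA, hB, ?_⟩
  rw [HomPolyBasics.homPoly_map_equiv]

/-- **Orbit sums of monomial exponents at level `n` lie in the span of the homomorphism polynomials of patterns
with at most `n` row vertices and `n` column vertices** (the induction of `HomSpan.orbitSum_mem_span_homPoly` on the
number of rows and columns USED, with the level — not the degree — as the bound: a monomial uses at most `n` rows
and `n` columns). [cite: DwivediPagoSeppelt2026, §8] -/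
theorem orbitSum_mem_span_homPoly_level {n : ℕ} :
    ∀ (ν : ℕ) (D : (Fin n × Fin n) →₀ ℕ),
      (D.support.image Prod.fst).card + (D.support.image Prod.snd).card = ν →
      (∑ g : Equiv.Perm (Fin n) × Equiv.Perm (Fin n),
          monomial (D.mapDomain fun ij : Fin n × Fin n => (g.1 ij.1, g.2 ij.2)) (1 : ℂ)) ∈
        Submodule.span ℂ {q : MvPolynomial (Fin n × Fin n) ℂ | ∃ (a b : ℕ) (E : Multiset (Fin a × Fin b)),
          a ≤ n ∧ b ≤ n ∧ q = homPoly E n ℂ} := by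
  intro ν
  induction ν using Nat.strong_induction_on with
  | _ ν ih =>
  intro D hν
  obtain ⟨A, B, iA, dA, iB, dB, E, h₀, hEA, hEB, h₁, h₂, hD, hcA, hcB, -⟩ := HomSpan.exists_presentation D
  -- the set of injective placements
  set I : Finset ((A → Fin n) × (B → Fin n)) :=
    Finset.univ.filter fun h => Function.Injective h.1 ∧ Function.Injective h.2 with hI
  have h₀I : h₀ ∈ I := Finset.mem_filter.2 ⟨Finset.mem_univ _, h₁, h₂⟩
  -- Reynolds identity for `hom_{F_D}` split along `I`
  have hR := HomSpan.card_smul_homPoly_eq_sum_orbitSum E n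
  rw [← Finset.sum_filter_add_sum_filter_not Finset.univ
    (fun h : (A → Fin n) × (B → Fin n) => Function.Injective h.1 ∧ Function.Injective h.2)] at hR
  -- injective placements all give `orbitSum D`
  have hinj : ∑ h ∈ I, ∑ g : Equiv.Perm (Fin n) × Equiv.Perm (Fin n),
      monomial ((Multiset.toFinsupp (E.map fun e => (h.1 e.1, h.2 e.2))).mapDomain
        fun ij : Fin n × Fin n => (g.1 ij.1, g.2 ij.2)) (1 : ℂ) =
      (I.card : ℂ) • ∑ g : Equiv.Perm (Fin n) × Equiv.Perm (Fin n),
        monomial (D.mapDomain fun ij : Fin n × Fin n => (g.1 ij.1, g.2 ij.2)) (1 : ℂ) := by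
    rw [Finset.sum_congr rfl fun h hh => ?_, Finset.sum_const, ← Nat.cast_smul_eq_nsmul ℂ]
    obtain ⟨-, hh1, hh2⟩ := Finset.mem_filter.1 hh
    rw [HomSpan.orbitSum_push_eq_of_injective E h₀ h h₁ h₂ hh1 hh2, hD]
  -- non-injective placements use fewer rows or columns
  have hnon : ∀ h ∈ Finset.univ.filter (fun h : (A → Fin n) × (B → Fin n) =>
      ¬ (Function.Injective h.1 ∧ Function.Injective h.2)),
      (∑ g : Equiv.Perm (Fin n) × Equiv.Perm (Fin n),
        monomial ((Multiset.toFinsupp (E.map fun e => (h.1 e.1, h.2 e.2))).mapDomain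
          fun ij : Fin n × Fin n => (g.1 ij.1, g.2 ij.2)) (1 : ℂ)) ∈
        Submodule.span ℂ {q : MvPolynomial (Fin n × Fin n) ℂ | ∃ (a b : ℕ) (E : Multiset (Fin a × Fin b)),
          a ≤ n ∧ b ≤ n ∧ q = homPoly E n ℂ} := by
    intro h hh
    obtain ⟨-, hh⟩ := Finset.mem_filter.1 hh
    refine ih _ ?_ _ rfl
    rw [← hν, HomSpan.support_push_image_fst E hEA, HomSpan.support_push_image_snd E hEB, ← hcA, ← hcB]
    have le1 : (Finset.univ.image h.1).card ≤ Fintype.card A := Finset.card_image_le.trans (by simp)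
    have le2 : (Finset.univ.image h.2).card ≤ Fintype.card B := Finset.card_image_le.trans (by simp)
    rcases not_and_or.1 hh with hn1 | hn2
    · have lt1 : (Finset.univ.image h.1).card < Fintype.card A := by
        refine lt_of_le_of_ne le1 fun heq => hn1 ?_
        have := Finset.injOn_of_card_image_eq (s := Finset.univ) (f := h.1)
          (by rw [Finset.card_univ]; exact heq)
        simpa [Set.injOn_univ] using this
      omega
    · have lt2 : (Finset.univ.image h.2).card < Fintype.card B := by
        refine lt_of_le_of_ne le2 fun heq => hn2 ?_
        have := Finset.injOn_of_card_image_eq (s := Finset.univ) (f := h.2)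
          (by rw [Finset.card_univ]; exact heq)
        simpa [Set.injOn_univ] using this
      omega
  -- the pattern's own homomorphism polynomial is a generator: it has `≤ n` rows and `≤ n` columns
  have hhom : homPoly E n ℂ ∈ Submodule.span ℂ {q : MvPolynomial (Fin n × Fin n) ℂ |
      ∃ (a b : ℕ) (E : Multiset (Fin a × Fin b)), a ≤ n ∧ b ≤ n ∧ q = homPoly E n ℂ} := by
    refine Submodule.subset_span (homPoly_mem_levelSet E n ?_ ?_)
    · rw [hcA]
      exact (Finset.card_le_univ _).trans (Fintype.card_fin n).le
    · rw [hcB]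
      exact (Finset.card_le_univ _).trans (Fintype.card_fin n).le
  -- solve for `orbitSum D`
  have hIne : (I.card : ℂ) ≠ 0 := Nat.cast_ne_zero.2 (Finset.card_ne_zero.2 ⟨h₀, h₀I⟩)
  rw [hinj] at hR
  have hsolve : (∑ g : Equiv.Perm (Fin n) × Equiv.Perm (Fin n),
      monomial (D.mapDomain fun ij : Fin n × Fin n => (g.1 ij.1, g.2 ij.2)) (1 : ℂ)) =
      (I.card : ℂ)⁻¹ • ((Fintype.card (Equiv.Perm (Fin n) × Equiv.Perm (Fin n)) : ℂ) • homPoly E n ℂ -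
        ∑ h ∈ Finset.univ.filter (fun h : (A → Fin n) × (B → Fin n) =>
            ¬ (Function.Injective h.1 ∧ Function.Injective h.2)),
          ∑ g : Equiv.Perm (Fin n) × Equiv.Perm (Fin n),
            monomial ((Multiset.toFinsupp (E.map fun e => (h.1 e.1, h.2 e.2))).mapDomain
              fun ij : Fin n × Fin n => (g.1 ij.1, g.2 ij.2)) (1 : ℂ)) := by
    rw [hR, add_sub_cancel_right, smul_smul, inv_mul_cancel₀ hIne, one_smul]
  rw [hsolve]
  exact Submodule.smul_mem _ _ (Submodule.sub_mem _ (Submodule.smul_mem _ _ hhom)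
    (Submodule.sum_mem _ hnon))

/-- **Matrix-symmetric polynomials at level `n` are combinations of homomorphism polynomials of patterns with at
most `n` row and `n` column vertices** (Reynolds identity + `orbitSum_mem_span_homPoly_level`). [cite: DwivediPagoSeppelt2026, §8] -/
theorem mem_span_homPoly_level_of_matrixSymmetric {n : ℕ} (p : MvPolynomial (Fin n × Fin n) ℂ)
    (hp : ∀ σ τ : Equiv.Perm (Fin n),
      rename (fun ij : Fin n × Fin n => (σ ij.1, τ ij.2)) p = p) :
    p ∈ Submodule.span ℂ {q : MvPolynomial (Fin n × Fin n) ℂ | ∃ (a b : ℕ) (E : Multiset (Fin a × Fin b)),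
      a ≤ n ∧ b ≤ n ∧ q = homPoly E n ℂ} := by
  have hG : (Fintype.card (Equiv.Perm (Fin n) × Equiv.Perm (Fin n)) : ℂ) ≠ 0 :=
    Nat.cast_ne_zero.2 Fintype.card_ne_zero
  have key := HomSpan.card_smul_eq_sum_orbitSum p hp
  have hmem : (Fintype.card (Equiv.Perm (Fin n) × Equiv.Perm (Fin n)) : ℂ) • p ∈
      Submodule.span ℂ {q : MvPolynomial (Fin n × Fin n) ℂ | ∃ (a b : ℕ) (E : Multiset (Fin a × Fin b)),
        a ≤ n ∧ b ≤ n ∧ q = homPoly E n ℂ} := by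
    rw [key]
    exact Submodule.sum_mem _ fun D _ => Submodule.smul_mem _ _
      (orbitSum_mem_span_homPoly_level _ D rfl)
  have := Submodule.smul_mem _ ((Fintype.card (Equiv.Perm (Fin n) × Equiv.Perm (Fin n)) : ℂ)⁻¹) hmem
  rwa [smul_smul, inv_mul_cancel₀ hG, one_smul] at this

/-- ★ **LEVEL FLOOR.**  Every matrix-symmetric polynomial on the `n × n` matrix lies in the bipartite narrow span of
width `2n - 1`: the filtration of the matrix-symmetric polynomials at level `n` by the treewidth of the spanning
bipartite patterns is exhausted at width `2n - 1`, in EVERY degree (patterns with `≤ n + n` vertices have treewidth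
`≤ 2n - 1`). [folklore] -/
theorem mem_narrowSpan_level_of_matrixSymmetric {n : ℕ} (p : MvPolynomial (Fin n × Fin n) ℂ)
    (hp : ∀ σ τ : Equiv.Perm (Fin n),
      rename (fun ij : Fin n × Fin n => (σ ij.1, τ ij.2)) p = p) :
    p ∈ Submodule.span ℂ {q : MvPolynomial (Fin n × Fin n) ℂ | ∃ (a b : ℕ) (F : Multiset (Fin a × Fin b)),
      treewidth (SimpleGraph.fromRel fun u v : Fin a ⊕ Fin b =>
          ∃ e ∈ F, u = Sum.inl e.1 ∧ v = Sum.inr e.2) ≤ 2 * n - 1 ∧ q = homPoly F n ℂ} := by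
  refine Submodule.span_mono ?_ (mem_span_homPoly_level_of_matrixSymmetric p hp)
  rintro q ⟨a, b, E, ha, hb, rfl⟩
  refine ⟨a, b, E, ?_, rfl⟩
  refine (Literature.Combinatorics.SimpleGraph.treewidth_le_card_sub_one _).trans ?_
  simp only [Fintype.card_sum, Fintype.card_fin]
  omega

/-! ### Bookkeeping on `(log₂ n + c)^c` -/

/-- **A level carrying a matrix-symmetric polynomial outside the width-`(log₂ n + c')^{c'}` bipartite span is
`≥ 2`** (levels `0` and `1` are exhausted at width `1 ≤ (0 + c')^{c'}` by the level floor). [folklore] -/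
theorem two_le_of_not_mem {n c' : ℕ} (p : MvPolynomial (Fin n × Fin n) ℂ)
    (hp : ∀ σ τ : Equiv.Perm (Fin n),
      rename (fun ij : Fin n × Fin n => (σ ij.1, τ ij.2)) p = p)
    (hW : p ∉ Submodule.span ℂ {q : MvPolynomial (Fin n × Fin n) ℂ | ∃ (a b : ℕ) (F : Multiset (Fin a × Fin b)),
      treewidth (SimpleGraph.fromRel fun u v : Fin a ⊕ Fin b =>
          ∃ e ∈ F, u = Sum.inl e.1 ∧ v = Sum.inr e.2) ≤ (Nat.log 2 n + c') ^ c' ∧ q = homPoly F n ℂ}) :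
    2 ≤ n := by
  by_contra hn
  push Not at hn
  apply hW
  refine OrbitToNarrowOfDescent.narrowSpan_mono n ?_ (mem_narrowSpan_level_of_matrixSymmetric p hp)
  have h1 : 1 ≤ (Nat.log 2 n + c') ^ c' := by
    rcases Nat.eq_zero_or_pos c' with rfl | hc'
    · simp
    · exact Nat.one_le_pow _ _ (by omega)
  omega

/-- **… and satisfies `c' < 2n`** (`c' ≤ (log₂ n + c')^{c'} < 2n - 1` by the level floor). [folklore] -/
theorem lt_level_of_not_mem {n c' : ℕ} (p : MvPolynomial (Fin n × Fin n) ℂ)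
    (hp : ∀ σ τ : Equiv.Perm (Fin n),
      rename (fun ij : Fin n × Fin n => (σ ij.1, τ ij.2)) p = p)
    (hW : p ∉ Submodule.span ℂ {q : MvPolynomial (Fin n × Fin n) ℂ | ∃ (a b : ℕ) (F : Multiset (Fin a × Fin b)),
      treewidth (SimpleGraph.fromRel fun u v : Fin a ⊕ Fin b =>
          ∃ e ∈ F, u = Sum.inl e.1 ∧ v = Sum.inr e.2) ≤ (Nat.log 2 n + c') ^ c' ∧ q = homPoly F n ℂ}) :
    c' < 2 * n := by
  by_contra hn
  push Not at hn
  apply hW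
  refine OrbitToNarrowOfDescent.narrowSpan_mono n ?_ (mem_narrowSpan_level_of_matrixSymmetric p hp)
  exact le_trans (by omega) (IsQPBounded.le_qexp (Nat.log 2 n) c')

end LevelFloor

end Summit.ValiantsHypothesis.ValiantsHypothesis.Theorems

end
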